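import Summits.ABC.ABC.Theorems.RibetTakahashiSplitManyPrimeValuationProductStubFermatInputKnownFrey
import Literature.NumberTheory.DiophantineGeometry.GeneralizedFermatTwoPowerCoefficient
import Literature.NumberTheory.DiophantineGeometry.GeneralizedFermatTwoPowerCoefficientExponentThree
import Literature.NumberTheory.DiophantineGeometry.AbcWave0

/-!
# Stub `stub_depthFrey` of line `switching-triangle` (crux stmt-ABC-1563): conditional discharge

Helper (`--supports stmt-ABC-1563`) for the registered stub

  `stub_depthFrey : ∃ B, ∀ W [IsElliptic], (∀ p odd prime, p² ∤ N) → ¬ Squarefree N →`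
  `  (W ≅ freyCurve (d a) (d b), a b coprime, ab(a+b) ≠ 0, d ∣ 2) → MP(W).Nonempty → G(W) ≤ B`

of the line `switching-triangle` for the crux
`Summit.ABC.ABC.Theses.RibetTakahashiSplit.FewPrimeValuationProduct`, where `N = N_E` is the
conductor, `MP(W) = {p ∣ N : p² ∤ N}` the set of multiplicative primes, `c_p = ord_p(Δ_min)` and
the DEPTH `G(W) = gcd_{p ∈ MP(W)} c_p`. It is landed in its registered CONDITIONAL form
`stub_depthFrey_of_namedFacts` (ledger, 2026-08-16): conditional on Fermat's Last Theorem
(Mathlib's `FermatLastTheorem`), K. Ribet, Acta Arith. 79 (1997) (`ribet1997_twoPowerFermat`),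
Darmon–Merel, J. reine angew. Math. 490 (1997) (`darmonMerel1997_denesEquation`) and
Darmon–Granville, Bull. LMS 27 (1995) Thm 2 (`darmonGranville1995_thm_2`), all UNPROVED named
facts of the tree taken as hypotheses.

The argument (H. Pasten, *Shimura curves and the abc conjecture*, arXiv:1705.09251, proof of
Lemma 6.12, run at EVERY odd prime `ℓ`, plus a Darmon–Granville finiteness for the `2`-part):
* `N` not squarefree but `p² ∤ N` for odd `p` means `4 ∣ N` (`two_sq_dvd_of_not_squarefree`), so
  every multiplicative prime is ODD, and for `W ≅ freyCurve (d a) (d b)` the odd multiplicative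
  primes are exactly the odd primes of `ab(a+b)`, with `c_p = 2 v_p(ab(a+b))`
  (`mem_filter_iff_dvd_of_smul_eq_freyCurve`, from the tree's
  `factorization_conductorNorm_freyCurve_twist` / `factorization_minimalDiscriminantNorm_freyCurve_twist`);
* an odd prime `ℓ ∣ G` makes every odd exponent of `(ab(a+b))²` a multiple of `ℓ`; the Fermat
  extraction (`exists_genFermat_of_dvd_factorization`, tree) gives `x^ℓ + 2^m y^ℓ + z^ℓ = 0` in
  pairwise coprime integers with every odd prime of `ab(a+b)` dividing `xyz`, and
  `|xyz| ≤ 1` — for `ℓ ≥ 5` by FLT / Ribet / Darmon–Merel, for `ℓ = 3` by the PROVED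
  `fermatTwoPower_three` (Euler, Legendre, `fermatLastTheoremThree`) — contradicts the existence of
  an (odd) multiplicative prime (`depthFrey_not_odd_prime_dvd`); so `G = 2^k`;
* if `8 ∣ G` then `4 ∣ v_p(ab(a+b))` for every odd `p`, so `a = A x⁴`, `b = B y⁴`, `a + b = C z⁴`
  with `A, B, C ∈ {±1, ±2, ±4, ±8}` and `gcd(x, y, z) = 1` (`exists_eq_coeff_mul_pow_four`): a
  proper solution of one of `8³` generalized Fermat equations of signature `(4, 4, 4)`, each with
  finitely many proper solutions by Darmon–Granville's Theorem 2; hence `|ab(a+b)| ≤ M` on this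
  class (`exists_natAbs_le_of_darmonGranville`) and `G ≤ c_r = 2 v_r(ab(a+b)) ≤ 2M` at any
  multiplicative prime `r`;
* so `B := max 4 (2M)` works (`depthFrey_le_of_namedFacts`, `stub_depthFrey_of_namedFacts`).

Not here: any restatement of the four named facts, any attempt at the unconditional statement.
-/

-- `Summit.<Summit>.<Problem>` is the mandated summit-side namespace (CONVENTIONS §2); for the
-- single-conjunct summit `ABC` the two coincide, so the duplicate `ABC.ABC` is deliberate.
set_option linter.dupNamespace false

namespace Summit.ABC.ABC.Theorems.FewPrimeValuationProduct

open WeierstrassCurve Literature.NumberTheory.EllipticCurves Literature.NumberTheory.DiophantineGeometry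
open Summit.ABC.ABC.Theorems.ManyPrimeValuationProduct

/-! ## The generalized Fermat equation `x^ℓ + 2^m y^ℓ + z^ℓ = 0` at every odd prime `ℓ` -/

/-- **Every solution of `x^ℓ + 2^m y^ℓ + z^ℓ = 0` (`ℓ` an odd prime, `m < ℓ`) in pairwise coprime
integers has `|xyz| ≤ 1`**, from the three named facts at `ℓ ≥ 5` — `m = 0`: Fermat's Last Theorem
(Mathlib's `FermatLastTheorem`, via `fermatLastTheoremFor_iff_int`); `2 ≤ m < ℓ`:
`ribet1997_twoPowerFermat`; `m = 1`: `darmonMerel1997_denesEquation` (`(x, y, z) = ±(1, −1, 1)`) —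
and from the PROVED exponent-`3` trichotomy `fermatTwoPower_three` (Euler, Legendre,
`fermatLastTheoremThree`) at `ℓ = 3`. This is the trichotomy of H. Pasten, arXiv:1705.09251, proof
of Lemma 6.12 (= H. Cohen, GTM 240, Thm 15.3.1), there used for `ℓ ≥ 11` only
(`genFermat_two_power_trivial`, same proof). `[folklore]` -/
theorem genFermat_twoPower_trivial_of_namedFacts (hFLT : FermatLastTheorem)
    (hR : ribet1997_twoPowerFermat) (hDM : darmonMerel1997_denesEquation) {ℓ : ℕ} (hℓ : ℓ.Prime)
    (hℓ2 : ℓ ≠ 2) {x y z : ℤ} {m : ℕ} (hm : m < ℓ) (hxy : IsCoprime x y) (hxz : IsCoprime x z)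
    (hyz : IsCoprime y z) (heq : x ^ ℓ + 2 ^ m * y ^ ℓ + z ^ ℓ = 0) : (x * y * z).natAbs ≤ 1 := by
  by_cases h0 : x * y * z = 0
  · simp [h0]
  have hx0 : x ≠ 0 := fun h => h0 (by rw [h, zero_mul, zero_mul])
  have hy0 : y ≠ 0 := fun h => h0 (by rw [h, mul_zero, zero_mul])
  have hz0 : z ≠ 0 := fun h => h0 (by rw [h, mul_zero])
  rcases Nat.lt_or_ge ℓ 5 with hℓ5 | h5
  · -- `ℓ = 3`: Euler (`m = 1`), Legendre (`m = 2`), `fermatLastTheoremThree` (`m = 0`), all proved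
    obtain rfl : ℓ = 3 := by
      have h2 := hℓ.two_le
      interval_cases ℓ
      · exact absurd rfl hℓ2
      · rfl
      · exact absurd hℓ (by norm_num)
    rcases (fermatTwoPower_three hm hx0 hy0 hz0 hxz heq).2 with ⟨rfl, rfl, rfl⟩ | ⟨rfl, rfl, rfl⟩ <;>
      decide
  · rcases Nat.lt_or_ge m 2 with hm2 | hm2
    · interval_cases m
      · -- `m = 0`: Fermat's Last Theorem at the odd exponent `ℓ ≥ 5`
        exfalso
        have hodd : Odd ℓ := hℓ.odd_of_ne_two hℓ2
        refine fermatLastTheoremFor_iff_int.mp (hFLT ℓ (by omega)) x y (-z) hx0 hy0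
          (neg_ne_zero.mpr hz0) ?_
        rw [hodd.neg_pow]
        linear_combination heq
      · -- `m = 1`: Darmon–Merel
        rcases hDM ℓ hℓ h5 x y z h0 hxy hxz hyz (by linear_combination heq) with
          ⟨rfl, rfl, rfl⟩ | ⟨rfl, rfl, rfl⟩ <;> decide
    · -- `2 ≤ m < ℓ`: Ribet
      exact absurd heq (hR ℓ hℓ h5 m hm2 hm x y z h0 hxy hxz hyz)

/-! ## Curves semistable away from `2` and additive at `2`; the twisted Frey curve at odd primes -/

/-- If `p² ∤ n` for every odd prime `p` but `n` is not squarefree, then `4 ∣ n`. `[folklore]` -/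
theorem two_sq_dvd_of_not_squarefree {n : ℕ} (hss : ∀ p : ℕ, p.Prime → p ≠ 2 → ¬ p ^ 2 ∣ n)
    (hnsf : ¬ Squarefree n) : 2 ^ 2 ∣ n := by
  by_contra h2
  refine hnsf (Nat.squarefree_iff_prime_squarefree.mpr fun p hp hpn => ?_)
  rw [← sq] at hpn
  by_cases hp2 : p = 2
  · subst hp2; exact h2 hpn
  · exact hss p hp hp2 hpn

/-- If `4 ∣ n`, every prime `p ∣ n` with `p² ∤ n` is odd (`2` is not a multiplicative prime of a
curve additive at `2`). `[folklore]` -/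
theorem ne_two_of_mem_filter_not_sq_dvd {n p : ℕ} (h4 : 2 ^ 2 ∣ n)
    (hp : p ∈ n.primeFactors.filter (fun p => ¬ p ^ 2 ∣ n)) : p ≠ 2 := by
  rintro rfl
  exact (Finset.mem_filter.mp hp).2 h4

/-- For `W` `ℚ`-isomorphic to the twisted Frey–Hellegouarch curve `y² = x (x − da) (x + db)`
(`a, b` coprime, `ab(a+b) ≠ 0`, `d ∣ 2`) and an odd prime `p`: `p` is a multiplicative prime of
`W` (`p ∣ N`, `p² ∤ N`) iff `p ∣ ab(a+b)` — the conductor exponent at `p` is `[p ∣ ab(a+b)]`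
(`factorization_conductorNorm_freyCurve_twist`; Frey 1986, Bombieri–Gubler Ex. 12.5.10).
`[folklore]` -/
theorem mem_filter_iff_dvd_of_smul_eq_freyCurve (W : WeierstrassCurve ℚ) [W.IsElliptic]
    {a b d : ℤ} {C : VariableChange ℚ} (hab : IsCoprime a b) (h0 : a * b * (a + b) ≠ 0)
    (hd : d ∣ 2) (hC : C • W = freyCurve (d * a) (d * b)) {p : ℕ} (hp : p.Prime) (hp2 : p ≠ 2) :
    p ∈ (W.conductorNorm ℤ).primeFactors.filter (fun p => ¬ p ^ 2 ∣ W.conductorNorm ℤ) ↔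
      (p : ℤ) ∣ a * b * (a + b) := by
  have hN0 : W.conductorNorm ℤ ≠ 0 := (conductorNorm_pos_holds W).ne'
  have hfN := factorization_conductorNorm_freyCurve_twist hab h0 hd hp hp2
  rw [← conductorNorm_eq_of_smul_eq hC] at hfN
  constructor
  · intro hmem
    by_contra hpm
    rw [if_neg hpm] at hfN
    have hpF := (Finset.mem_filter.mp hmem).1
    rw [← Nat.support_factorization, Finsupp.mem_support_iff] at hpF
    exact hpF hfN
  · intro hpm
    rw [if_pos hpm] at hfN
    refine Finset.mem_filter.mpr ⟨Nat.mem_primeFactors.mpr ⟨hp, ?_, hN0⟩, fun h => ?_⟩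
    · exact Nat.dvd_of_factorization_pos (by rw [hfN]; exact one_ne_zero)
    · have := (hp.pow_dvd_iff_le_factorization hN0).mp h
      rw [hfN] at this
      omega

/-- For `W` `ℚ`-isomorphic to `freyCurve (d a) (d b)` (`a, b` coprime, `ab(a+b) ≠ 0`, `d ∣ 2`) and
an odd prime `p`: `ord_p Δ_min(W) = 2 v_p(ab(a+b))` (`Δ_min` is a `ℚ`-isomorphism invariant;
`factorization_minimalDiscriminantNorm_freyCurve_twist`, Bombieri–Gubler Ex. 12.5.10).
`[folklore]` -/
theorem factorization_minimalDiscriminantNorm_of_smul_eq_freyCurve (W : WeierstrassCurve ℚ)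
    {a b d : ℤ} {C : VariableChange ℚ} (hab : IsCoprime a b) (h0 : a * b * (a + b) ≠ 0)
    (hd : d ∣ 2) (hC : C • W = freyCurve (d * a) (d * b)) {p : ℕ} (hp : p.Prime) (hp2 : p ≠ 2) :
    (W.minimalDiscriminantNorm ℤ).factorization p = 2 * (a * b * (a + b)).natAbs.factorization p := by
  rw [minimalDiscriminantNorm_eq_of_smul_eq hC]
  exact factorization_minimalDiscriminantNorm_freyCurve_twist hab h0 hd hp hp2

/-! ## The odd part of the depth -/

/-- **No odd prime divides the depth of a twisted Frey–Hellegouarch curve additive at `2`**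
(conditional on FLT, Ribet 1997, Darmon–Merel 1997). For `W/ℚ` elliptic with `p² ∤ N` for odd `p`,
`N` not squarefree, `W ≅ freyCurve (d a) (d b)` (`a, b` coprime, `ab(a+b) ≠ 0`, `d ∣ 2`) and at
least one multiplicative prime, and an odd prime `ℓ`: `ℓ ∤ G(W) = gcd_{p ∈ MP(W)} ord_p(Δ_min)`.
Proof (H. Pasten, arXiv:1705.09251, proof of Lemma 6.12): if `ℓ ∣ G` then `ℓ ∣ ord_p(Δ_min) =
2 v_p(ab(a+b))` at every odd prime `p` (the odd primes of `ab(a+b)` are multiplicative), the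
Fermat extraction yields `x^ℓ + 2^m y^ℓ + z^ℓ = 0` with every odd prime of `ab(a+b)` dividing
`xyz`, and `|xyz| = 1` (`genFermat_twoPower_trivial_of_namedFacts`); but `4 ∣ N`, so a
multiplicative prime `r` is odd and divides `ab(a+b)`, hence `r ∣ xyz = ±1`. `[folklore]` -/
theorem depthFrey_not_odd_prime_dvd (hFLT : FermatLastTheorem) (hR : ribet1997_twoPowerFermat)
    (hDM : darmonMerel1997_denesEquation) {ℓ : ℕ} (hℓ : ℓ.Prime) (hℓ2 : ℓ ≠ 2)
    (W : WeierstrassCurve ℚ) [W.IsElliptic]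
    (hss : ∀ p : ℕ, p.Prime → p ≠ 2 → ¬ p ^ 2 ∣ W.conductorNorm ℤ)
    (hnsf : ¬ Squarefree (W.conductorNorm ℤ)) {a b d : ℤ} {C : VariableChange ℚ}
    (hab : IsCoprime a b) (h0 : a * b * (a + b) ≠ 0) (hd : d ∣ 2)
    (hC : C • W = freyCurve (d * a) (d * b))
    (hne : ((W.conductorNorm ℤ).primeFactors.filter (fun p => ¬ p ^ 2 ∣ W.conductorNorm ℤ)).Nonempty) :
    ¬ ℓ ∣ ((W.conductorNorm ℤ).primeFactors.filter (fun p => ¬ p ^ 2 ∣ W.conductorNorm ℤ)).gcd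
      (fun p => (W.minimalDiscriminantNorm ℤ).factorization p) := by
  intro hℓG
  -- every odd-prime exponent of `(ab(a+b))²` is a multiple of `ℓ`
  have hdiv : ∀ p : ℕ, p.Prime → p ≠ 2 → ℓ ∣ 2 * (a * b * (a + b)).natAbs.factorization p := by
    intro p hp hp2
    by_cases hpm : (p : ℤ) ∣ a * b * (a + b)
    · have hmem := (mem_filter_iff_dvd_of_smul_eq_freyCurve W hab h0 hd hC hp hp2).mpr hpm
      have h : ℓ ∣ (W.minimalDiscriminantNorm ℤ).factorization p := hℓG.trans (Finset.gcd_dvd hmem)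
      rwa [factorization_minimalDiscriminantNorm_of_smul_eq_freyCurve W hab h0 hd hC hp hp2] at h
    · rw [Nat.factorization_eq_zero_of_not_dvd (fun h' => hpm (Int.natCast_dvd.mpr h')), mul_zero]
      exact dvd_zero _
  obtain ⟨x, y, z, m, hm, hxy, hxz, hyz, -, -, hxyz, heq, hp⟩ :=
    exists_genFermat_of_dvd_factorization hab h0 hℓ hℓ2 hdiv
  have h1 : (x * y * z).natAbs = 1 := by
    have := genFermat_twoPower_trivial_of_namedFacts hFLT hR hDM hℓ hℓ2 hm hxy hxz hyz heq
    have h0' : (x * y * z).natAbs ≠ 0 := Int.natAbs_ne_zero.mpr hxyz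
    omega
  -- a multiplicative prime `r` is odd (`4 ∣ N`) and divides `ab(a+b)`, hence divides `xyz = ±1`
  obtain ⟨r, hr⟩ := hne
  have hrp : r.Prime := Nat.prime_of_mem_primeFactors (Finset.mem_filter.mp hr).1
  have hr2 : r ≠ 2 := ne_two_of_mem_filter_not_sq_dvd (two_sq_dvd_of_not_squarefree hss hnsf) hr
  have hrm := (mem_filter_iff_dvd_of_smul_eq_freyCurve W hab h0 hd hC hrp hr2).mp hr
  have := Int.natCast_dvd.mp (hp r hrp hr2 hrm)
  rw [h1, Nat.dvd_one] at this
  exact hrp.one_lt.ne' this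

/-! ## The `2`-part of the depth: fourth powers and Darmon–Granville -/

/-- If `4 ∣ v_p(u)` for every odd prime `p` (`u ≠ 0`), then `u = A x⁴` with
`A ∈ {±1, ±2, ±4, ±8}`: `|u| = 2^e k⁴` with `k` odd
(`exists_eq_two_pow_mul_pow_of_dvd_factorization`), `A = sign(u) 2^{e mod 4}`,
`x = 2^{⌊e/4⌋} k`. `[folklore]` -/
theorem exists_eq_coeff_mul_pow_four {u : ℤ} (hu : u ≠ 0)
    (h : ∀ p : ℕ, p.Prime → p ≠ 2 → 4 ∣ u.natAbs.factorization p) :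
    ∃ A ∈ ({1, -1, 2, -2, 4, -4, 8, -8} : Finset ℤ), ∃ x : ℤ, u = A * x ^ 4 := by
  obtain ⟨k, -, hk⟩ :=
    exists_eq_two_pow_mul_pow_of_dvd_factorization (Int.natAbs_ne_zero.mpr hu) (by norm_num) h
  set e := u.natAbs.factorization 2 with he
  have hcast : (u.natAbs : ℤ) = 2 ^ e * (k : ℤ) ^ 4 := by rw [hk]; push_cast; ring
  have hu' : u = (u.sign * 2 ^ (e % 4)) * (2 ^ (e / 4) * k) ^ 4 := by
    calc u = u.sign * (u.natAbs : ℤ) := (Int.sign_mul_natAbs u).symm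
      _ = u.sign * (2 ^ (e % 4 + 4 * (e / 4)) * (k : ℤ) ^ 4) := by rw [hcast, Nat.mod_add_div]
      _ = (u.sign * 2 ^ (e % 4)) * (2 ^ (e / 4) * k) ^ 4 := by ring
  refine ⟨u.sign * 2 ^ (e % 4), ?_, 2 ^ (e / 4) * k, hu'⟩
  have hsign : u.sign = 1 ∨ u.sign = -1 := by
    rcases lt_or_gt_of_ne hu with hneg | hpos
    · exact Or.inr (Int.sign_eq_neg_one_of_neg hneg)
    · exact Or.inl (Int.sign_eq_one_of_pos hpos)
  have hr : e % 4 < 4 := Nat.mod_lt _ (by norm_num)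
  generalize e % 4 = r at hr ⊢
  interval_cases r <;> rcases hsign with hs | hs <;> rw [hs] <;> decide

/-- `gcd(x, y, z) = 1` (in the form `({x, y, z} : Finset ℤ).gcd id = 1` of
`darmonGranville1995_thm_2`) as soon as `x, y` are coprime. `[folklore]` -/
theorem gcd_three_eq_one_of_isCoprime {x y : ℤ} (z : ℤ) (hxy : IsCoprime x y) :
    ({x, y, z} : Finset ℤ).gcd id = 1 := by
  have hx : ({x, y, z} : Finset ℤ).gcd id ∣ x := Finset.gcd_dvd (f := id) (by simp)
  have hy : ({x, y, z} : Finset ℤ).gcd id ∣ y := Finset.gcd_dvd (f := id) (by simp)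
  rw [← Finset.normalize_gcd]
  exact normalize_eq_one.mpr (hxy.isUnit_of_dvd' hx hy)

/-- **Darmon–Granville makes the class `8 ∣ G` finite.** From Darmon–Granville 1995, Theorem 2
(the named fact `darmonGranville1995_thm_2`: `A x^p + B y^q = C z^r` has finitely many proper
solutions when `1/p + 1/q + 1/r < 1`; here `(p, q, r) = (4, 4, 4)`): there is `M` such that for all
coprime `a, b` with `ab(a+b) ≠ 0` and `4 ∣ v_p(ab(a+b))` for every odd prime `p`, `|ab(a+b)| ≤ M`.
Indeed `4 ∣ v_p(a), v_p(b), v_p(a+b)` (coprimality), so `a = A x⁴`, `b = B y⁴`, `a + b = C z⁴`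
with `A, B, C ∈ {±1, ±2, ±4, ±8}` (`exists_eq_coeff_mul_pow_four`) and `gcd(x, y, z) = 1`
(`x ∣ a`, `y ∣ b`): `(a, b)` lies in the finite union over the `8³` coefficient triples of the
images `(A x⁴, B y⁴)` of the finite sets of proper solutions.
[cite: DarmonGranville1995, Theorem 2 (p. 515)] -/
theorem exists_natAbs_le_of_darmonGranville (hDG : darmonGranville1995_thm_2) :
    ∃ M : ℕ, ∀ a b : ℤ, IsCoprime a b → a * b * (a + b) ≠ 0 →
      (∀ p : ℕ, p.Prime → p ≠ 2 → 4 ∣ (a * b * (a + b)).natAbs.factorization p) →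
      (a * b * (a + b)).natAbs ≤ M := by
  classical
  have hS0 : ∀ A ∈ ({1, -1, 2, -2, 4, -4, 8, -8} : Finset ℤ), A ≠ 0 := by decide
  -- the finitely many proper solutions of the finitely many equations `A x⁴ + B y⁴ = C z⁴`
  have hFfin : (⋃ c ∈ (({1, -1, 2, -2, 4, -4, 8, -8} : Finset ℤ) ×ˢ
      (({1, -1, 2, -2, 4, -4, 8, -8} : Finset ℤ) ×ˢ ({1, -1, 2, -2, 4, -4, 8, -8} : Finset ℤ))),
      (fun t : ℤ × ℤ × ℤ => (c.1 * t.1 ^ 4, c.2.1 * t.2.1 ^ 4)) ''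
        {t : ℤ × ℤ × ℤ | ({t.1, t.2.1, t.2.2} : Finset ℤ).gcd id = 1 ∧
          c.1 * t.1 ^ 4 + c.2.1 * t.2.1 ^ 4 = c.2.2 * t.2.2 ^ 4}).Finite := by
    refine Set.Finite.biUnion (Finset.finite_toSet _) fun c hc => Set.Finite.image _ ?_
    obtain ⟨hA, hBC⟩ := Finset.mem_product.mp hc
    obtain ⟨hB, hC⟩ := Finset.mem_product.mp hBC
    exact hDG c.1 c.2.1 c.2.2 (hS0 _ hA) (hS0 _ hB) (hS0 _ hC) (by norm_num)
  obtain ⟨M, hM⟩ := (hFfin.image fun ab : ℤ × ℤ => (ab.1 * ab.2 * (ab.1 + ab.2)).natAbs).bddAbove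
  refine ⟨M, fun a b hab h0 h4 => mem_upperBounds.mp hM _ (Set.mem_image_of_mem _ (x := (a, b)) ?_)⟩
  -- `a = A x⁴`, `b = B y⁴`, `a + b = C z⁴`
  have ha0 : a ≠ 0 := fun h' => h0 (by rw [h']; ring)
  have hb0 : b ≠ 0 := fun h' => h0 (by rw [h']; ring)
  have hc0 : a + b ≠ 0 := fun h' => h0 (by rw [h']; ring)
  have hac : IsCoprime a (a + b) := by simpa using hab.mul_add_left_right 1
  have hbc : IsCoprime b (a + b) := by simpa using hab.symm.add_mul_left_right 1
  obtain ⟨A, hA, x, hx⟩ := exists_eq_coeff_mul_pow_four ha0 fun p hp _ =>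
    dvd_factorization_natAbs_of_isCoprime (hab.mul_right hac) ha0 (mul_ne_zero hb0 hc0) hp
      (by rw [← mul_assoc]; exact h4 p hp ‹_›)
  obtain ⟨B, hB, y, hy⟩ := exists_eq_coeff_mul_pow_four hb0 fun p hp _ =>
    dvd_factorization_natAbs_of_isCoprime (hab.symm.mul_right hbc) hb0 (mul_ne_zero ha0 hc0) hp
      (by rw [show b * (a * (a + b)) = a * b * (a + b) by ring]; exact h4 p hp ‹_›)
  obtain ⟨C, hC, z, hz⟩ := exists_eq_coeff_mul_pow_four hc0 fun p hp _ =>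
    dvd_factorization_natAbs_of_isCoprime (hac.symm.mul_right hbc.symm) hc0 (mul_ne_zero ha0 hb0) hp
      (by rw [show (a + b) * (a * b) = a * b * (a + b) by ring]; exact h4 p hp ‹_›)
  have hxa : x ∣ a := by rw [hx]; exact dvd_mul_of_dvd_right (dvd_pow_self x (by norm_num)) A
  have hyb : y ∣ b := by rw [hy]; exact dvd_mul_of_dvd_right (dvd_pow_self y (by norm_num)) B
  have hxy : IsCoprime x y := (hab.of_isCoprime_of_dvd_left hxa).of_isCoprime_of_dvd_right hyb
  rw [Set.mem_iUnion₂]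
  refine ⟨(A, B, C), Finset.mem_product.mpr ⟨hA, Finset.mem_product.mpr ⟨hB, hC⟩⟩, (x, y, z),
    ⟨gcd_three_eq_one_of_isCoprime z hxy, ?_⟩, ?_⟩
  · dsimp only
    rw [← hx, ← hy, ← hz]
  · dsimp only
    rw [hx, hy]

/-! ## Assembly -/

/-- **The depth of twisted Frey–Hellegouarch curves additive at `2` is uniformly bounded**
(conditional on FLT, Ribet 1997, Darmon–Merel 1997, Darmon–Granville 1995 Thm 2). With `M` from
`exists_natAbs_le_of_darmonGranville`, `B := max 4 (2M)` bounds `G(W) = gcd_{p ∈ MP(W)} c_p` for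
every elliptic `W/ℚ` with `p² ∤ N` for odd `p`, `N` not squarefree, `W ≅ freyCurve (d a) (d b)`
(`a, b` coprime, `ab(a+b) ≠ 0`, `d ∣ 2`) and a multiplicative prime: `G` has no odd prime factor
(`depthFrey_not_odd_prime_dvd`), so `G = 2^k`; if `k ≤ 2` then `G ≤ 4`; if `k ≥ 3` then
`8 ∣ c_p = 2 v_p(ab(a+b))` at every odd multiplicative `p`, i.e. `4 ∣ v_p(ab(a+b))` at every odd
prime, so `|ab(a+b)| ≤ M` and `G ≤ c_r = 2 v_r(ab(a+b)) ≤ 2 |ab(a+b)| ≤ 2M` at a multiplicative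
(odd) prime `r`. `[folklore]` -/
theorem depthFrey_le_of_namedFacts (hFLT : FermatLastTheorem) (hR : ribet1997_twoPowerFermat)
    (hDM : darmonMerel1997_denesEquation) (hDG : darmonGranville1995_thm_2) :
    ∃ B : ℕ, ∀ (W : WeierstrassCurve ℚ) [W.IsElliptic],
      (∀ p : ℕ, p.Prime → p ≠ 2 → ¬ p ^ 2 ∣ W.conductorNorm ℤ) → ¬ Squarefree (W.conductorNorm ℤ) →
      (∃ (a b d : ℤ) (C : VariableChange ℚ), IsCoprime a b ∧ a * b * (a + b) ≠ 0 ∧ d ∣ 2 ∧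
        C • W = freyCurve (d * a) (d * b)) →
      ((W.conductorNorm ℤ).primeFactors.filter (fun p => ¬ p ^ 2 ∣ W.conductorNorm ℤ)).Nonempty →
      ((W.conductorNorm ℤ).primeFactors.filter (fun p => ¬ p ^ 2 ∣ W.conductorNorm ℤ)).gcd
        (fun p => (W.minimalDiscriminantNorm ℤ).factorization p) ≤ B := by
  obtain ⟨M, hM⟩ := exists_natAbs_le_of_darmonGranville hDG
  refine ⟨max 4 (2 * M), ?_⟩
  intro W _ hss hnsf hFrey hne
  obtain ⟨a, b, d, C, hab, h0, hd, hC⟩ := hFrey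
  rcases Nat.eq_two_pow_or_exists_odd_prime_and_dvd
      (((W.conductorNorm ℤ).primeFactors.filter (fun p => ¬ p ^ 2 ∣ W.conductorNorm ℤ)).gcd
        (fun p => (W.minimalDiscriminantNorm ℤ).factorization p)) with ⟨k, hk⟩ | ⟨ℓ, hℓ, hℓG, hℓodd⟩
  · rcases Nat.lt_or_ge k 3 with hk3 | hk3
    · rw [hk]
      calc 2 ^ k ≤ 2 ^ 2 := Nat.pow_le_pow_right (by norm_num) (by omega)
        _ ≤ max 4 (2 * M) := le_max_left _ _
    · -- `8 ∣ G`: all odd valuations of `ab(a+b)` are multiples of `4`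
      have h8 : ∀ p ∈ (W.conductorNorm ℤ).primeFactors.filter (fun p => ¬ p ^ 2 ∣ W.conductorNorm ℤ),
          2 ^ k ∣ (W.minimalDiscriminantNorm ℤ).factorization p := fun p hp => by
        rw [← hk]; exact Finset.gcd_dvd hp
      obtain ⟨r, hr⟩ := hne
      have hrp : r.Prime := Nat.prime_of_mem_primeFactors (Finset.mem_filter.mp hr).1
      have hr2 : r ≠ 2 := ne_two_of_mem_filter_not_sq_dvd (two_sq_dvd_of_not_squarefree hss hnsf) hr
      have hrm := (mem_filter_iff_dvd_of_smul_eq_freyCurve W hab h0 hd hC hrp hr2).mp hr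
      have h4 : ∀ p : ℕ, p.Prime → p ≠ 2 → 4 ∣ (a * b * (a + b)).natAbs.factorization p := by
        intro p hp hp2
        by_cases hpm : (p : ℤ) ∣ a * b * (a + b)
        · have h := h8 p ((mem_filter_iff_dvd_of_smul_eq_freyCurve W hab h0 hd hC hp hp2).mpr hpm)
          rw [factorization_minimalDiscriminantNorm_of_smul_eq_freyCurve W hab h0 hd hC hp hp2] at h
          have h8' : 2 * 4 ∣ 2 * (a * b * (a + b)).natAbs.factorization p :=
            (pow_dvd_pow 2 hk3).trans h
          exact Nat.dvd_of_mul_dvd_mul_left (by norm_num) h8'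
        · rw [Nat.factorization_eq_zero_of_not_dvd (fun h' => hpm (Int.natCast_dvd.mpr h'))]
          exact dvd_zero _
      have hle := hM a b hab h0 h4
      have hv0 : (a * b * (a + b)).natAbs ≠ 0 := Int.natAbs_ne_zero.mpr h0
      have hcr := factorization_minimalDiscriminantNorm_of_smul_eq_freyCurve W hab h0 hd hC hrp hr2
      have hvr : 0 < (a * b * (a + b)).natAbs.factorization r :=
        hrp.factorization_pos_of_dvd hv0 (Int.natCast_dvd.mp hrm)
      have hlt := Nat.factorization_lt r hv0
      calc ((W.conductorNorm ℤ).primeFactors.filter (fun p => ¬ p ^ 2 ∣ W.conductorNorm ℤ)).gcd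
            (fun p => (W.minimalDiscriminantNorm ℤ).factorization p)
            ≤ (W.minimalDiscriminantNorm ℤ).factorization r :=
            Nat.le_of_dvd (by rw [hcr]; omega) (Finset.gcd_dvd hr)
        _ ≤ 2 * M := by rw [hcr]; omega
        _ ≤ max 4 (2 * M) := le_max_right _ _
  · exact absurd hℓG (depthFrey_not_odd_prime_dvd hFLT hR hDM hℓ (hℓodd.ne_two_of_dvd_nat dvd_rfl)
      W hss hnsf hab h0 hd hC hne)

/-- **Registered conditional form of `stub_depthFrey` (line `switching-triangle`, crux
stmt-ABC-1563): the depth of twisted Frey–Hellegouarch curves additive at `2` is uniformly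
bounded, conditional on exactly four NAMED facts** — Fermat's Last Theorem (Mathlib's
`FermatLastTheorem`; Wiles, Taylor–Wiles), Ribet 1997 (`ribet1997_twoPowerFermat`: `x^p + 2^r y^p +
z^p = 0`, `2 ≤ r < p`), Darmon–Merel 1997 (`darmonMerel1997_denesEquation`: `x^p + 2 y^p + z^p = 0`)
— together H. Pasten, arXiv:1705.09251, Lemma 6.12 at every odd prime `ℓ ≥ 5` (`ℓ = 3` is
proved: Euler, Legendre) — and Darmon–Granville 1995 Thm 2 (`darmonGranville1995_thm_2`, for the
`8³` equations `A x⁴ + B y⁴ = C z⁴`, bounding the `2`-part). For every elliptic `W/ℚ` with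
`p² ∤ N` for odd `p`, `N` not squarefree, `W ≅ freyCurve (d a) (d b)` (`a, b` coprime,
`ab(a+b) ≠ 0`, `d ∣ 2`) and a multiplicative prime: `gcd_{p ∣ N, p² ∤ N} ord_p(Δ_min) ≤ B`.
Binder-free restatement of `depthFrey_le_of_namedFacts` (the form registered on the ledger,
2026-08-16). [cite: PastenShimura2024, Lemma 6.12 p. 23 (proof)] -/
theorem stub_depthFrey_of_namedFacts : FermatLastTheorem → Literature.NumberTheory.DiophantineGeometry.ribet1997_twoPowerFermat → Literature.NumberTheory.DiophantineGeometry.darmonMerel1997_denesEquation → Literature.NumberTheory.DiophantineGeometry.darmonGranville1995_thm_2 → ∃ B : ℕ, ∀ (W : WeierstrassCurve ℚ) [W.IsElliptic], (∀ p : ℕ, p.Prime → p ≠ 2 → ¬ p ^ 2 ∣ W.conductorNorm ℤ) → ¬ Squarefree (W.conductorNorm ℤ) → (∃ (a b d : ℤ) (C : WeierstrassCurve.VariableChange ℚ), IsCoprime a b ∧ a * b * (a + b) ≠ 0 ∧ d ∣ 2 ∧ C • W = Literature.NumberTheory.EllipticCurves.freyCurve (d * a) (d * b)) → ((W.conductorNorm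 ℤ).primeFactors.filter (fun p => ¬ p ^ 2 ∣ W.conductorNorm ℤ)).Nonempty → ((W.conductorNorm ℤ).primeFactors.filter (fun p => ¬ p ^ 2 ∣ W.conductorNorm ℤ)).gcd (fun p => (W.minimalDiscriminantNorm ℤ).factorization p) ≤ B :=
  fun hFLT hR hDM hDG => depthFrey_le_of_namedFacts hFLT hR hDM hDG

end Summit.ABC.ABC.Theorems.FewPrimeValuationProduct
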